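import Mathlib
import HarnessLib
import Summits.ValiantsHypothesis.ValiantsHypothesis.Theses.ValuativeGCT
import Summits.ValiantsHypothesis.ValiantsHypothesis.Theorems.ValuativeGCTTailFlipStubIsobaricInheritance
import Summits.ValiantsHypothesis.ValiantsHypothesis.Theorems.ValuativeGCTTailFlipStubIsobaricSizeLift
import Summits.ValiantsHypothesis.ValiantsHypothesis.Theorems.ValuativeGCTTailFlipCertificateDomination
import Summits.ValiantsHypothesis.ValiantsHypothesis.Theorems.TailFlip.Negative.TailFlipKillTransfer
import Literature.Computability.Complexity.OccurrenceObstructionsIPProofs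

/-!
# Skeleton — line `Sketch` (idea `isobaric-anchors`) for crux `ValuativeGCT.TailFlip`
(stmt-ValiantsHypothesis-15687); opening lead prover-line-stmt-ValiantsHypothesis-15687-0 (cycle 1),
continuation lead prover-line-stmt-ValiantsHypothesis-15687-c1-0 (cycle 2, 2026-08-16).

Letters: inner (permanent) size `N = K + i`, anchor size `K`, padding `j`, determinant size
`m = N + j = K + i + j`, outer degree `δ`, inner top variable `x_t = X (topMatIdx K)`.

Composition (`TailFlip_of`, sorry-free over the stubs, concludes the crux BY NAME):
at a tail position `(N, N + j)` the census stub hands an ANCHORED ISOBARIC CERTIFICATE — inner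
highest-weight vectors `F₁ … F_D` of weight `μ*` (`μ ⊢ Kδ`) at anchor size `K`, inner points
`A_l · per_K` that are `x_t`-isobaric (every monomial has the same `x_t`-exponent `e₀ l`), with
NONSINGULAR UNTWISTED evaluation matrix — together with an admissible centre `(U, r)` at size `m`
whose valuative truncation at the doubly row-lifted shape `(μ♯(K+i))♯m` has dimension `< D`;
the LANDED per-side half `Theorems.TailFlip.anchored_le_orbitMultiplicity` (p118501 = stubs
`stub_isobaricSizeLift` p117574 + `stub_isobaricInheritance` p117890: transport to inner size `K + i`
by the block `per_K ⊕ x_t·I_i`, then untwist the Kadish–Landsberg twist, a scalar on isobaric points)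
turns it into `D ≤ mult_{((μ♯(K+i))♯m)*} ℂ[Δ_m(X₀₀^j per_{K+i})]` for EVERY padding `j`, and the
census closes the strict inequality.  Cycle 2 state: stubs 1–2 are landed and IMPORTED (the glue is
landed too, p118501, and kept here as a local copy only so that the file elaborates on every farm node);
the single open stub is `stub_isobaricTailCensus` (the residual: per-side anchor
TABLE + det-side CENSUS), honestly OPEN and of the crux's strength — it implies the crux
(`TailFlip_of`) and hence `DcPerSuperpolynomial ℂ` (`Negative.dcPerSuperpolynomial_of_tailFlip`),
and any witness exhibits a padded anchor `X₀₀^j · x_t^i · (A_l · per_K)` OUTSIDE `Δ(det_m)`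
(`Theorems.TailFlip.exists_not_mem_orbitClosure_det_of_finrank_truncation_lt`, p117876) at every
`m ≤ 2^((log₂ N + c)^c)`, i.e. a super-quasi-polynomial border-determinantal lower bound for permanent
sections.

Sorries live only in `stub_*`.  [Cruxes/TailFlip/Ideas/isobaric-anchors.md; Cruxes/TailFlip/Lines/Sketch.md;
Cruxes/ValuativeFlip/SiegeStubs.lean `tailFlip_of_certificates`; arXiv:1512.03798 Prop. 2.6(b);
BurgisserIkenmeyerPanovaJAMS2019 Lemma 5.2, Thm 5.4; arXiv:0907.2850 §6.4 Problem 6.10;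
Bläser–Ikenmeyer 2025 §12.4]
-/

set_option linter.dupNamespace false
set_option maxHeartbeats 800000

namespace Summit.ValiantsHypothesis.ValiantsHypothesis.Cruxes.TailFlip.IsobaricAnchors

open MvPolynomial
open scoped BigOperators Matrix
open Literature.NumberTheory.DiophantineGeometry
open Literature.Computability.AlgebraicComplexity
open Literature.Computability.Complexity
open Summit.ValiantsHypothesis.ValiantsHypothesis.Theorems.TailFlip

noncomputable section

/-! ## Stubs 1–2 (LANDED, imported): `Theorems.TailFlip.stub_isobaricInheritance` (p117890),
`Theorems.TailFlip.stub_isobaricSizeLift` (p117574); their glue is landed as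
`Theorems.TailFlip.anchored_le_orbitMultiplicity` (p118501, `Theorems/ValuativeGCTTailFlipAnchoredInheritance`). -/

/-! ## Stub 3 — the residual: anchored isobaric certificates beating the valuative census (OPEN) -/

/-- **stub_isobaricTailCensus** — THE RESIDUAL OF THE LINE (OPEN, crux-strength; per-side anchor
TABLE + det-side CENSUS in one statement because they are coupled through the size `D` and the
shape).  For every slope `a/b > 1` and every `c`, eventually in `N`, at every tail position
`m = N + j` (`a·N < b·m ≤ 2^((log₂ N + c)^c)`), there are an anchor size `K ≥ 1` with `K + i = N`, a
degree `δ`, an anchor shape `μ ⊢ Kδ` (`≤ K²` parts), inner highest-weight vectors `F₁ … F_D` of weight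
`μ*` at size `K`, `x_t`-isobaric anchor points `A_l · per_K` with NONSINGULAR UNTWISTED evaluation
matrix (the table entry `R ≥ D`), and an admissible centre `(U, r)` at size `K + i + j` whose valuative
truncation (verbatim the crux's `T`, at size `K + i + j`, degree `δ`, weight `((μ♯(K+i))♯(K+i+j))*`)
has dimension `< D` (the census).  Constraints any witness must meet (recorded, not assumed):
the padded anchor points must lie OUTSIDE `Δ(det_{K+i+j})` (else `D ≤ K_m ≤ dim T_U`,
ValuativeBound; `exists_not_mem_orbitClosure_det_of_finrank_truncation_lt`), forcing `2^K ≳ j`; `ℓ(μ) → ∞`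
along the window (`Negative.not_tailFlipLen`); `δ(m-N) ≤` first row (Kadish–Landsberg, automatic for
row-lifted shapes).  Honest label: OPEN — it implies the crux (`TailFlip_of`) and therefore
`DcPerSuperpolynomial ℂ`; sandwiched like the crux (`GctKroneckerFlip ⇒ TailFlip ⇒ GctMultFlip` on the tail).
[Cruxes/TailFlip/Ideas/isobaric-anchors.md §Transfer; Cruxes/ValuativeFlip/SiegeStubs.lean `stub_tailCertificates`;
arXiv:1204.4693 Thm 1.2; Bläser–Ikenmeyer 2025 §12.4] -/
theorem stub_isobaricTailCensus :
    ∀ a b : ℕ, b < a → ∀ c : ℕ, ∃ n₀ : ℕ, ∀ N ≥ n₀, ∀ (j : ℕ),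
      a * N < b * (N + j) → N + j ≤ 2 ^ ((Nat.log 2 N + c) ^ c) →
      ∃ (K i : ℕ) (_ : NeZero K) (_ : K + i = N) (δ : ℕ) (μ : Nat.Partition (K * δ)) (D : ℕ)
        (F : Fin D → MvPolynomial (DegIdx (MatIdx K) K) ℂ) (A : Fin D → Matrix (MatIdx K) (MatIdx K) ℂ)
        (e₀ : Fin D → ℕ) (U : Submodule ℂ (MatIdx (K + i + j) → ℂ)) (r : ℕ),
        μ.parts.card ≤ K * K ∧
        (∀ i', F i' ∈ highestWeightSpace (coordRep (MatIdx K) ℂ K) (partitionWeightLex K μ)) ∧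
        (∀ l, ∀ e ∈ (linSubst (MatIdx K) ℂ (A l) (paddedPerFormLex ℂ K K)).support, e (topMatIdx K) = e₀ l) ∧
        (Matrix.of fun i' l : Fin D => MvPolynomial.aeval
            (fun e : DegIdx (MatIdx K) K =>
              MvPolynomial.coeff e.1 (linSubst (MatIdx K) ℂ (A l) (paddedPerFormLex ℂ K K))) (F i')).det ≠ 0 ∧
        (∀ u ∈ U, (Matrix.of fun a b : Fin (K + i + j) => u (toLex (a, b))).rank ≤ r) ∧
        Module.finrank ℂ ↥(MvPolynomial.homogeneousSubmodule (MatIdx (K + i + j) × MatIdx (K + i + j)) ℂ ((K + i + j) * δ) ⊓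
            ((MvPolynomial.vanishingIdeal ℂ {p : MatIdx (K + i + j) × MatIdx (K + i + j) → ℂ |
                ∀ j' : MatIdx (K + i + j), (fun i => p (j', i)) ∈ U}) ^ (δ * ((K + i + j) - r))).restrictScalars ℂ ⊓
            (⨅ (M : Matrix (MatIdx (K + i + j)) (MatIdx (K + i + j)) ℂ)
              (_ : linSubst (MatIdx (K + i + j)) ℂ M (detFormLex ℂ (K + i + j)) = detFormLex ℂ (K + i + j)),
              LinearMap.ker ((MvPolynomial.aeval (R := ℂ) fun p : MatIdx (K + i + j) × MatIdx (K + i + j) =>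
                  ∑ l : MatIdx (K + i + j), M l p.2 • MvPolynomial.X (p.1, l)).toLinearMap -
                LinearMap.id (R := ℂ) (M := MvPolynomial (MatIdx (K + i + j) × MatIdx (K + i + j)) ℂ))) ⊓
            (⨅ (g : Matrix.GeneralLinearGroup (MatIdx (K + i + j)) ℂ) (_ : IsUpperTriangular g),
              LinearMap.ker ((MvPolynomial.aeval (R := ℂ) fun p : MatIdx (K + i + j) × MatIdx (K + i + j) =>
                  ∑ l : MatIdx (K + i + j), ((g⁻¹ : Matrix.GeneralLinearGroup (MatIdx (K + i + j)) ℂ) :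
                    Matrix (MatIdx (K + i + j)) (MatIdx (K + i + j)) ℂ) p.1 l • MvPolynomial.X (l, p.2)).toLinearMap -
                weightChar (partitionWeightLex (K + i + j) (rowLift (rowLift μ i) j)) g •
                  LinearMap.id (R := ℂ) (M := MvPolynomial (MatIdx (K + i + j) × MatIdx (K + i + j)) ℂ)))) < D := by
  sorry

/-! ## Glue (sorry-free over the stub; every other ingredient is a landed theorem) -/

/-- A doubly row-lifted shape `(μ♯(K+i))♯(K+i+j)` of a shape with `≤ K²` parts has `≤ (K+i+j)²` parts
(`K ≥ 1`).  (= the landed `Theorems.TailFlip.card_parts_rowLift_rowLift_le`, p118501; local copy so that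
this workfile elaborates on farm nodes that have not yet built that module.) [folklore] -/
theorem card_parts_rowLift_rowLift_le {K δ : ℕ} [NeZero K] (μ : Nat.Partition (K * δ))
    (hμ : μ.parts.card ≤ K * K) (i j : ℕ) :
    (rowLift (rowLift μ i) j).parts.card ≤ (K + i + j) * (K + i + j) := by
  have hK : 1 ≤ K := Nat.one_le_iff_ne_zero.2 (NeZero.ne K)
  have hKK : 1 ≤ K * K := Nat.one_le_iff_ne_zero.2 (mul_ne_zero (NeZero.ne K) (NeZero.ne K))
  have h1 : (rowLift μ i).parts.card ≤ K * K := (card_parts_rowLift_le μ i).trans (max_le hμ hKK)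
  have h2 : (rowLift (rowLift μ i) j).parts.card ≤ K * K :=
    (card_parts_rowLift_le _ j).trans (max_le h1 hKK)
  exact h2.trans (Nat.mul_le_mul (by omega) (by omega))

/-- **Anchored inheritance** (the per-side half of the line; = the landed
`Theorems.TailFlip.anchored_le_orbitMultiplicity`, p118501, local copy for the same reason).  ONE isobaric
untwisted certificate of size `D` at anchor size `K` bounds the padded-permanent multiplicity from below at
EVERY inner size `K + i` and EVERY padding `j`. [Cruxes/TailFlip/Ideas/isobaric-anchors.md §(1),(4)] -/
theorem anchored_le_orbitMultiplicity (K i j δ : ℕ) [NeZero K] [NeZero (K + i)] [NeZero (K + i + j)]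
    (μ : Nat.Partition (K * δ)) (hμ : μ.parts.card ≤ K * K)
    (D : ℕ) (F : Fin D → MvPolynomial (DegIdx (MatIdx K) K) ℂ)
    (hF : ∀ i', F i' ∈ highestWeightSpace (coordRep (MatIdx K) ℂ K) (partitionWeightLex K μ))
    (A : Fin D → Matrix (MatIdx K) (MatIdx K) ℂ) (e₀ : Fin D → ℕ)
    (hiso : ∀ l, ∀ e ∈ (linSubst (MatIdx K) ℂ (A l) (paddedPerFormLex ℂ K K)).support, e (topMatIdx K) = e₀ l)
    (hdet : (Matrix.of fun i' l : Fin D => MvPolynomial.aeval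
        (fun e : DegIdx (MatIdx K) K =>
          MvPolynomial.coeff e.1 (linSubst (MatIdx K) ℂ (A l) (paddedPerFormLex ℂ K K))) (F i')).det ≠ 0) :
    D ≤ orbitMultiplicity ℂ (paddedPerFormLex ℂ (K + i) (K + i + j)) (K + i + j)
      (partitionWeightLex (K + i + j) (rowLift (rowLift μ i) j)) := by
  obtain ⟨F', A', hF', hiso', hdet'⟩ := stub_isobaricSizeLift K i δ μ hμ D F hF A e₀ hiso hdet
  have hμ' : (rowLift μ i).parts.card ≤ (K + i) * (K + i) :=
    (card_parts_rowLift_le μ i).trans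
      (max_le (hμ.trans (Nat.mul_le_mul (Nat.le_add_right K i) (Nat.le_add_right K i)))
        (Nat.one_le_iff_ne_zero.2 (mul_ne_zero (NeZero.ne (K + i)) (NeZero.ne (K + i)))))
  exact stub_isobaricInheritance (K + i) j δ (rowLift μ i) hμ' D F' hF' A' (fun l => e₀ l + i) hiso' hdet'

/-- **The crux from the stub**: `ValuativeGCT.TailFlip` BY NAME.  At a tail position `(N, N + j)`
take the anchored isobaric certificate and the centre of `stub_isobaricTailCensus`, substitute
`N = K + i`, bound the padded-permanent multiplicity from below by the landed anchored inheritance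
`Theorems.TailFlip.anchored_le_orbitMultiplicity` (size lift `K ↦ K + i`, then the isobaric engine at
padding `j`), and compare with the census.  Sorry-free over the single open stub. [this file] -/
theorem TailFlip_of :
    Summit.ValiantsHypothesis.ValiantsHypothesis.Theses.ValuativeGCT.TailFlip := by
  intro a b hba c
  obtain ⟨n₀, hn₀⟩ := stub_isobaricTailCensus a b hba c
  refine ⟨max n₀ 1, fun N hN m _ hlt hm => ?_⟩
  have hN0 : n₀ ≤ N := le_of_max_le_left hN
  have hNm : N < m := Negative.lt_of_slope hba hlt
  obtain ⟨j, rfl⟩ : ∃ j, m = N + j := ⟨m - N, by omega⟩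
  obtain ⟨K, i, hK, hKi, δ, μ, D, F, A, e₀, U, r, hμ, hF, hiso, hdet, hU, hcensus⟩ :=
    hn₀ N hN0 j hlt hm
  subst hKi
  haveI : NeZero (K + i) := ⟨by have := NeZero.ne K; omega⟩
  have hD := anchored_le_orbitMultiplicity K i j δ μ hμ D F hF A e₀ hiso hdet
  refine ⟨U, r, δ, rowLift (rowLift μ i) j, hU, card_parts_rowLift_rowLift_le μ hμ i j, ?_⟩
  intro χ T
  exact lt_of_lt_of_le hcensus hD

end

end Summit.ValiantsHypothesis.ValiantsHypothesis.Cruxes.TailFlip.IsobaricAnchors
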